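import Literature.MathematicalPhysics.QuantumFieldTheory.Balaban1983to89.Node00.BgConstraintOfRecord
import Summits.QuantumFields.YangMills.Theorems.BalabanUVNodesN07QOfRecordGaugeCovariance
import Literature.MathematicalPhysics.QuantumFieldTheory.Balaban1983to89.B7TransferAnalyticMean
import HarnessLib

/-!
# NODE N07 — T-C1′: def-Y's NONLINEAR CONSTRAINT LETTER `C` (✓`Node00.COfRecord`, M2 file 3e′) HAS VANISHING DERIVATIVE AT `A′ = 0` ALONG EVERY HERMITIAN-TRACELESS
# DIRECTION — equivalently [B9] (3.13)∕[15] (44): `Q_k(U₀)` IS THE LINEARISATION OF THE LOG-COORDINATE OF THE AVERAGED CHART `(1/i) log(Ū^k(exp(itη_kA′)U₀)(Ū^kU₀)⋆)`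

Cell `pub-ymgap`, width seat `pub-ymgap-dag-n07-w3` (g25), INTENT-6 ∕ CLAIM-6.  `--kind proof --supports stmt-QuantumFields-27238 --as helper`; count-neutral.
[15] = [Balaban1985Variational]; [B9] = [Balaban1985BackgroundPropagators]; [I] = [Balaban1987RG1].

WHY.  def-Y's ✓`Node00/BgConstraintOfRecord.lean` defines `C(A′) = (1/i) log(Ū^k_h(exp(iη_kA′)U₀)·(Ū^kU₀)⋆) − Q_k(U₀)A′` with lit's HOLOMORPHIC average `Ū^k_h = iterMh k`
(adjugates on backward steps) and lists «`fderiv ℂ C 0 = 0`» as a token; this seat located (bus 2026-08-31T09:48Z, confirmed by RR-2 g29) that along the TRACE line `A′ = a•1`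
`C` is LINEAR (the adjugate and the adjoint differ off `SL(N)`), so the token holds only on print's directions — `𝔤ᶜ = 𝔰𝔩(N, ℂ)`, whose real form is the
Hermitian-traceless `η_kA′` of (19)∕(51) with `exp(iη_kA′(b)) ∈ SU(N)`.  RR-2's corrected token T-C1′ is the DIRECTIONAL statement proved here: along `t ↦ tA′` with
`η_kA′` Hermitian and traceless the chart `exp(itη_kA′)U₀` is a genuine `SU(N)` configuration — n07's exponential chart `expChart U₀ (t • Ad_{U₀⁻¹}(iη_kA′))` — on which
`iterMh = ↑Ū^k` (guard eventually along the chart), and n07-w1's ✓`hasDerivAt_coe_iter_expChart_smul` gives the velocity `Q_k(↑U₀)[iη_kA′·U₀]`; composing with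
`d(log)(1) = id` (lit ✓`B7TransferAnalyticMean.hasFDerivAt_mlog_one`) and reading def-Y's `qCplxOp` on Hermitian fields (`qCplxOp_apply_of_herm`, `η_kL^k = 1`, `i⁻¹ = −i`) the two
summands of `C` have THE SAME derivative, so `d/dt C(tA′)|₀ = 0`.

WHAT IS PROVED (sorry-free; no definition; axioms standard).
* §1 `star_I_smul_of_herm` ∕ `I_smul_mem_lieSU` (`iY ∈ 𝔰𝔲(N)` for Hermitian traceless `Y`), `coe_expChart_adInv_smul` (the matrix of n07's chart
  `expChart U₀ (t • Ad_{U₀⁻¹}(iY))` at a bond is `exp(itY(b))·U₀(b)` — `NormedSpace.exp_units_conj`), ★ `coeField_expChart_adInv_eq_expOver` (= def-Y's `expOver U₀ (t•Y)`).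
* §2 `eta_mul_L_pow` (`η_k·L^k = 1`), ★★ `hasDerivAt_logAvgChart_line` — the FIRST SUMMAND of `C` along `t ↦ tA′`,
  `t ↦ (1/i) log(Ū^k_h(exp(itY)U₀)(c)·(Ū^kU₀)(c)⋆)`, has derivative `−i·(Q_k(↑U₀)[iY·U₀](c)·(Ū^kU₀)(c)⋆)` at `0` (guard below `k`; `iterMh = ↑Ū^k` near `0` along the chart);
  ★★ `qCplxOp_of_herm_eq` — def-Y's `qCplxOp k U₀ (η_k⁻¹ • Y) c` IS that same matrix for Hermitian `Y` ([B9] (3.13) = [15] (44)'s linear term).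
* §3 ★★★ `hasDerivAt_COfRecord_line_zero` — for `A′` with `evLit … A′` Hermitian and traceless bondwise and `U₀` guarded:
  `HasDerivAt (fun t : ℝ ↦ C(t•A′)(c)) 0 0`; `deriv_COfRecord_line_zero`.

HONEST SCOPE.  One chain rule along an `SU(N)` curve + bookkeeping; DIRECTIONAL (real) statement on print's Hermitian-traceless directions only — on the trace line `C` is linear and
nothing is claimed; the ℂ-linear form «`fderiv ℂ C 0` vanishes on `𝔰𝔩(N)`-valued `A′`» (from def-Y's `analyticAt_COfRecord_zero` + this file + ℂ-linearity) is left to the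
consumer; no estimate ((44)'s `C₂` is NOT here); the guard `SmallBelow (avOfRecord F N K) k U₀` is displayed; P0 ⟨26900⟩ OPEN; K0ᴬ∕K1ᴬ∕K3ᴬ OPEN; N07 NOT discharged;
COUNT 8∕28 · K 1∕4 UNMOVED; finite `𝕋⁴` at fixed `ε` — R4 closes only the conditional finite-𝕋⁴ rung `BalabanLadder.UV`, never the summit; nothing continuum ∕ ℝ⁴ ∕ OS; the
Yang–Mills mass gap (Clay) is NOT proved by any of this.  No `sorry`, no `def`, no `instance`, no `notation`.

References: [15] (15) p. 280, (19)–(20) p. 281, (44) p. 285, (51) p. 286; [B9] (3.1)–(3.2) p. 390, (3.13)–(3.16) p. 393; [I] (0.4) p. 253, (0.21) p. 256.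
-/

set_option autoImplicit false

noncomputable section

open scoped Matrix Matrix.Norms.L2Operator InnerProductSpace ComplexConjugate Topology

namespace Summit.QuantumFields.YangMills.Theorems.N07ConstraintLetterTangent

open Filter
open Literature.MathematicalPhysics.QuantumFieldTheory.Balaban1983to89
open Literature.MathematicalPhysics.QuantumFieldTheory.Balaban1983to89.T4Continuum (T4Family)
open T4Continuum BlockAveraging
open NormedSpace (exp)
open ExpMeanLog (expMeanLogSU)
open MatrixLog (mlog mlog_one analyticAt_mlog)
open B15AveragingHolomorphic (iterMh)
open B11Eq115Space (NegSize NegSup levWeight)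
open T4AdjointCovarianceUnitary (lieSU mem_lieSU_iff expSU coe_expSU specialUnitaryAd coe_specialUnitaryAd)
open Node00
open Summit.QuantumFields.YangMills.Theorems.N07QOfRecordGaugeCovariance (leftVel_eq_rightVel)
open B7TransferAnalyticMean (hasFDerivAt_mlog_one)

variable {P : Params} {N : ℕ}

/-! ## §1  The Hermitian-traceless direction as an `𝔰𝔲(N)` chart: `exp(itY)·U₀ = expChart U₀ (t • Ad_{U₀⁻¹}(iY))` -/

/-- `(iY)⋆ = −iY` for Hermitian `Y`. [folklore] -/
theorem star_I_smul_of_herm {Y : Matrix (Fin N) (Fin N) ℂ} (hY : star Y = Y) : star (Complex.I • Y) = -(Complex.I • Y) := by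
  rw [star_smul, hY, Complex.star_def, Complex.conj_I, neg_smul]

/-- `iY ∈ 𝔰𝔲(N)` for Hermitian traceless `Y` (print's (19)∕(51): the real form of `𝔤ᶜ = 𝔰𝔩(N,ℂ)`). [cite: Balaban1985Variational, (19) p.281, (51) p.286] -/
theorem I_smul_mem_lieSU {Y : Matrix (Fin N) (Fin N) ℂ} (hY : star Y = Y) (htr : Y.trace = 0) : Complex.I • Y ∈ lieSU (Fin N) := by
  rw [mem_lieSU_iff]
  exact ⟨star_I_smul_of_herm hY, by rw [Matrix.trace_smul, htr, smul_zero]⟩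

/-- **THE MATRIX OF n07's CHART AT THE ROTATED DIRECTION**: `↑(expChart U₀ (t • (b ↦ Ad_{U₀(b)⁻¹} Z(b))) b) = exp(t•↑Z(b)) · ↑U₀(b)` (`exp(U⋆MU) = U⋆exp(M)U`).
[cite: Balaban1985Variational, (15) p.280; Balaban1985BackgroundPropagators, (3.1)–(3.2) p.390] -/
theorem coe_expChart_adInv_smul (U₀ : GaugeField P 0 (SU N)) (Z : PBond P 0 → lieSU (Fin N)) (t : ℝ) (b : PBond P 0) :
    ((expChart U₀ (t • fun b => specialUnitaryAd (U₀ b)⁻¹ (Z b)) b : SU N) : Matrix (Fin N) (Fin N) ℂ) =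
      exp (t • (Z b : Matrix (Fin N) (Fin N) ℂ)) * (U₀ b : Matrix (Fin N) (Fin N) ℂ) := by
  rw [coe_expChart, Pi.smul_apply, Submodule.coe_smul, coe_specialUnitaryAd, coe_inv_SU, star_star]
  have hconj : t • (star (U₀ b : Matrix (Fin N) (Fin N) ℂ) * (Z b : Matrix (Fin N) (Fin N) ℂ) * (U₀ b : Matrix (Fin N) (Fin N) ℂ)) =
      (((suToUnits N (U₀ b))⁻¹ : (Matrix (Fin N) (Fin N) ℂ)ˣ) : Matrix (Fin N) (Fin N) ℂ) * (t • (Z b : Matrix (Fin N) (Fin N) ℂ)) *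
        (((suToUnits N (U₀ b))⁻¹⁻¹ : (Matrix (Fin N) (Fin N) ℂ)ˣ) : Matrix (Fin N) (Fin N) ℂ) := by
    rw [inv_inv, coe_suToUnits, coe_suToUnits_inv, coe_inv_SU, mul_smul_comm, smul_mul_assoc]
  rw [hconj, Matrix.exp_units_conj, inv_inv, coe_suToUnits, coe_suToUnits_inv, coe_inv_SU, ← mul_assoc, ← mul_assoc, coe_mul_star_coe_SU, one_mul]

/-- ★ **THE SU(N) CURVE OF A HERMITIAN-TRACELESS DIRECTION IS def-Y's CHART**: for Hermitian traceless `Y` and `Z(b) = iY(b)`,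
`coeField (expChart U₀ (t • Ad_{U₀⁻¹}Z)) = expOver U₀ ((t:ℂ) • Y)` (`= (b ↦ exp(itY(b))·U₀(b))`). [cite: Balaban1985Variational, (15) p.280, (19) p.281] -/
theorem coeField_expChart_adInv_eq_expOver (U₀ : GaugeField P 0 (SU N)) {Y : PBond P 0 → Matrix (Fin N) (Fin N) ℂ}
    (hY : ∀ b, star (Y b) = Y b) (htr : ∀ b, (Y b).trace = 0) (t : ℝ) :
    coeField (expChart U₀ (t • fun b => specialUnitaryAd (U₀ b)⁻¹ ⟨Complex.I • Y b, I_smul_mem_lieSU (hY b) (htr b)⟩)) = expOver U₀ ((t : ℂ) • Y) := by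
  funext b
  rw [coeField_apply, coe_expChart_adInv_smul, expOver_apply, Pi.smul_apply]
  congr 2
  rw [Submodule.coe_mk, smul_comm, Complex.coe_smul]

/-! ## §2  The derivative of the first summand of `C` along `t ↦ tA′`, and def-Y's `qCplxOp` on Hermitian directions -/

/-- `η_k · L^k = 1` (`Params.eta k = (L⁻¹)^k`). [cite: Balaban1987RG1, (0.1) p.251 (bookkeeping)] -/
theorem eta_mul_L_pow (k : ℕ) : (((P.eta k : ℝ) : ℂ)) * ((P.L : ℂ) ^ k) = 1 := by
  have hL : (P.L : ℂ) ≠ 0 := Nat.cast_ne_zero.2 (Nat.pos_iff_ne_zero.1 P.L_pos)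
  rw [Params.eta, Complex.ofReal_pow, Complex.ofReal_inv, Complex.ofReal_natCast, inv_pow, inv_mul_cancel₀ (pow_ne_zero k hL)]

variable [NeZero N]

section Record

variable (F : T4Family) {K : ℕ} (k : ℕ) (Ω : ℕ → Set (Site (F.P K) 0)) (U₀ : GaugeField (F.P K) 0 (SU N)) (levB : PBond (F.P K) k → ℕ)

/-- ★★ **THE FIRST SUMMAND OF `C` ALONG `t ↦ tA′`** (`Y = η_kA′` Hermitian traceless, guard below `k`): `t ↦ (1/i) log(Ū^k_h(exp(itY)U₀)(c)·(Ū^kU₀)(c)⋆)` has derivative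
`i⁻¹·(Q_k(↑U₀)[b ↦ iY(b)·U₀(b)](c)·(Ū^kU₀)(c)⋆)` at `t = 0` — along the chart `Ū^k_h = ↑Ū^k` near `0` (guard eventually), n07-w1's velocity of `Ū^k`, and `d(log)(1) = id`.
[cite: Balaban1985Variational, (44) p.285; Balaban1985BackgroundPropagators, (3.13) p.393; Balaban1987RG1, (0.4) p.253] -/
theorem hasDerivAt_logAvgChart_line (hU₀ : SmallBelow (avOfRecord F N K) k U₀)
    {Y : PBond (F.P K) 0 → Matrix (Fin N) (Fin N) ℂ} (hY : ∀ b, star (Y b) = Y b) (htr : ∀ b, (Y b).trace = 0) (c : PBond (F.P K) k) :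
    HasDerivAt (fun t : ℝ => (Complex.I⁻¹ : ℂ) • mlog (iterMh k (expOver U₀ ((t : ℂ) • Y)) c *
        star ((Averaging.iter (avOfRecord F N K) k U₀ c : SU N) : Matrix (Fin N) (Fin N) ℂ)))
      ((Complex.I⁻¹ : ℂ) • (dIterL k (coeField U₀) (fun b => (Complex.I • Y b) * (U₀ b : Matrix (Fin N) (Fin N) ℂ)) c *
        star ((Averaging.iter (avOfRecord F N K) k U₀ c : SU N) : Matrix (Fin N) (Fin N) ℂ))) 0 := by
  -- the 𝔰𝔲(N) direction and n07's chart
  set Z : PBond (F.P K) 0 → lieSU (Fin N) := fun b => ⟨Complex.I • Y b, I_smul_mem_lieSU (hY b) (htr b)⟩ with hZ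
  set W : PBond (F.P K) 0 → lieSU (Fin N) := fun b => specialUnitaryAd (U₀ b)⁻¹ (Z b) with hW
  set V : Matrix (Fin N) (Fin N) ℂ := star ((Averaging.iter (avOfRecord F N K) k U₀ c : SU N) : Matrix (Fin N) (Fin N) ℂ) with hV
  -- the velocity of `↑Ū^k` along the chart (n07-w1), read in the left chart
  have hvel : HasDerivAt (fun t : ℝ => ((Averaging.iter (avOfRecord F N K) k (expChart U₀ (t • W)) c : SU N) : Matrix (Fin N) (Fin N) ℂ))
      (dIterL k (coeField U₀) (fun b => (U₀ b : Matrix (Fin N) (Fin N) ℂ) * (W b : Matrix (Fin N) (Fin N) ℂ)) c) 0 :=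
    hasDerivAt_coe_iter_expChart_smul hU₀ W c
  have hdir : (fun b => (U₀ b : Matrix (Fin N) (Fin N) ℂ) * (W b : Matrix (Fin N) (Fin N) ℂ)) =
      fun b => (Complex.I • Y b) * (U₀ b : Matrix (Fin N) (Fin N) ℂ) := by
    rw [hW, ← leftVel_eq_rightVel U₀ Z]
  rw [hdir] at hvel
  -- multiply by the constant `V` and compose with `log` at `1`
  have hmul := hvel.mul_const V
  have h0 : ((Averaging.iter (avOfRecord F N K) k (expChart U₀ ((0 : ℝ) • W)) c : SU N) : Matrix (Fin N) (Fin N) ℂ) * V = 1 := by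
    rw [zero_smul, expChart_zero, hV, coe_mul_star_coe_SU]
  have hlog : HasDerivAt (fun t : ℝ => mlog (((Averaging.iter (avOfRecord F N K) k (expChart U₀ (t • W)) c : SU N) : Matrix (Fin N) (Fin N) ℂ) * V))
      (dIterL k (coeField U₀) (fun b => (Complex.I • Y b) * (U₀ b : Matrix (Fin N) (Fin N) ℂ)) c * V) 0 := by
    have hl : HasFDerivAt (mlog : Matrix (Fin N) (Fin N) ℂ → Matrix (Fin N) (Fin N) ℂ)
        ((1 : Matrix (Fin N) (Fin N) ℂ →L[ℂ] Matrix (Fin N) (Fin N) ℂ).restrictScalars ℝ)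
        (((Averaging.iter (avOfRecord F N K) k (expChart U₀ ((0 : ℝ) • W)) c : SU N) : Matrix (Fin N) (Fin N) ℂ) * V) := by
      rw [h0]
      exact (hasFDerivAt_mlog_one (𝔄 := Matrix (Fin N) (Fin N) ℂ)).restrictScalars ℝ
    have hcomp := hl.comp_hasDerivAt (0 : ℝ) hmul
    simp only [ContinuousLinearMap.coe_restrictScalars', one_apply_eq_self] at hcomp
    exact hcomp
  have hsmul := hlog.const_smul (Complex.I⁻¹ : ℂ)
  -- along the chart, `iterMh = ↑Ū^k` eventually near `t = 0`
  have ht : Tendsto (fun t : ℝ => t • W) (𝓝 0) (𝓝 0) := by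
    have hc : Continuous fun t : ℝ => t • W := continuous_id.smul continuous_const
    simpa only [zero_smul] using hc.tendsto 0
  have hev : ∀ᶠ t : ℝ in 𝓝 0, SmallBelow (avOfRecord F N K) k (expChart U₀ (t • W)) := ht.eventually (eventually_smallBelow_expChart hU₀)
  refine HasDerivAt.congr_of_eventuallyEq hsmul (hev.mono fun t hst => ?_)
  show (Complex.I⁻¹ : ℂ) • mlog (iterMh k (expOver U₀ ((t : ℂ) • Y)) c * V) = _
  rw [← coeField_expChart_adInv_eq_expOver U₀ hY htr t, iterMh_coeField_of_smallBelow F N k _ hst, coeField_apply]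
  rfl

/-- ★★ **def-Y's `qCplxOp` ON A HERMITIAN DIRECTION IS THE SAME MATRIX**: for Hermitian `Y` (guard below `k`),
`qCplxOp k U₀ (η_k⁻¹ • Y) c = i⁻¹·(Q_k(↑U₀)[iY·U₀](c)·(Ū^kU₀)(c)⋆)` (`qCplxOp_apply_of_herm`, `qSkewOp_apply`, real-linearity of `Q_k`, `η_kL^k = 1`, `i⁻¹ = −i`).
[cite: Balaban1985BackgroundPropagators, (3.13)–(3.15) p.393; Balaban1985Variational, (44) p.285] -/
theorem qCplxOp_of_herm_eq (hU₀ : SmallBelow (avOfRecord F N K) k U₀)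
    {Y : PBond (F.P K) 0 → Matrix (Fin N) (Fin N) ℂ} (hY : ∀ b, star (Y b) = Y b) (c : PBond (F.P K) k) :
    qCplxOp k U₀ (((((F.P K).eta k : ℝ) : ℂ))⁻¹ • Y) c =
      (Complex.I⁻¹ : ℂ) • (dIterL k (coeField U₀) (fun b => (Complex.I • Y b) * (U₀ b : Matrix (Fin N) (Fin N) ℂ)) c *
        star ((Averaging.iter (avOfRecord F N K) k U₀ c : SU N) : Matrix (Fin N) (Fin N) ℂ)) := by
  have hη := eta_mul_L_pow (P := F.P K) k
  have hηne : ((((F.P K).eta k : ℝ) : ℂ)) ≠ 0 := by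
    intro h0; rw [h0, zero_mul] at hη; exact zero_ne_one hη
  have hYs : ∀ b, (((((((F.P K).eta k : ℝ) : ℂ))⁻¹ • Y) b)ᴴ) = (((((F.P K).eta k : ℝ) : ℂ))⁻¹ • Y) b := fun b => by
    rw [Pi.smul_apply, Matrix.conjTranspose_smul, ← Matrix.star_eq_conjTranspose, hY b, Complex.star_def, ← Complex.ofReal_inv, Complex.conj_ofReal]
  have hiter : iterM k (coeField U₀) = coeField (Averaging.iter (avOfRecord F N K) k U₀) := (coeField_iter_eq_iterM k hU₀).symm
  rw [qCplxOp_apply_of_herm k U₀ hYs, Pi.smul_apply, qSkewOp_apply, hiter, coeField_apply]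
  -- the direction `(−i·η⁻¹·Y)·U₀` is the REAL multiple `(−η⁻¹) • (iY·U₀)`
  have hdir : (fun b => (-Complex.I • ((((F.P K).eta k : ℝ) : ℂ))⁻¹ • Y) b * (U₀ b : Matrix (Fin N) (Fin N) ℂ)) =
      (-((F.P K).eta k)⁻¹ : ℝ) • fun b => (Complex.I • Y b) * (U₀ b : Matrix (Fin N) (Fin N) ℂ) := by
    funext b
    rw [Pi.smul_apply, Pi.smul_apply, Pi.smul_apply, ← Complex.coe_smul, smul_smul, smul_mul_assoc, smul_mul_assoc, smul_smul]
    congr 1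
    push_cast
    ring
  rw [hdir, map_smul, Pi.smul_apply, ← Complex.coe_smul, smul_mul_assoc, smul_smul, smul_smul]
  congr 1
  push_cast
  rw [Complex.inv_I]
  have h2 : ((((F.P K).L : ℂ)) ^ k)⁻¹ * ((((F.P K).eta k : ℝ) : ℂ))⁻¹ = 1 := by
    rw [← mul_inv, mul_comm, hη, inv_one]
  linear_combination (-Complex.I) * h2

/-! ## §3  `C` has vanishing derivative at `0` along every Hermitian-traceless direction -/

/-- ★★★ **T-C1′: `d/dt C(t•A′)(c)|_{t=0} = 0` FOR EVERY `A′` WHOSE PRESENTED FIELD IS HERMITIAN AND TRACELESS** (print's directions (19)∕(51)) at a guarded background —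
the two summands of def-Y's `COfRecord` have the same velocity (§2). (On the trace line `C` is linear and nothing is claimed.)
[cite: Balaban1985Variational, (44) p.285, (19) p.281, (51) p.286; Balaban1985BackgroundPropagators, (3.13) p.393] -/
theorem hasDerivAt_COfRecord_line_zero (hU₀ : SmallBelow (avOfRecord F N K) k U₀) (A : Space115Lit F N K k Ω U₀)
    (hH : ∀ b, star (evLit F N K k Ω U₀ A b) = evLit F N K k Ω U₀ A b) (htr : ∀ b, (evLit F N K k Ω U₀ A b).trace = 0) (c : PBond (F.P K) k) :
    HasDerivAt (fun t : ℝ => NegSup.equiv _ _ (COfRecord F N K k Ω U₀ levB ((t : ℂ) • A)) c) 0 0 := by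
  set Y : PBond (F.P K) 0 → Matrix (Fin N) (Fin N) ℂ := (((F.P K).eta k : ℝ) : ℂ) • evLit F N K k Ω U₀ A with hYdef
  have hY : ∀ b, star (Y b) = Y b := fun b => by
    rw [hYdef, Pi.smul_apply, star_smul, hH b, Complex.star_def, Complex.conj_ofReal]
  have hYtr : ∀ b, (Y b).trace = 0 := fun b => by rw [hYdef, Pi.smul_apply, Matrix.trace_smul, htr b, smul_zero]
  have hηne : ((((F.P K).eta k : ℝ) : ℂ)) ≠ 0 := by
    have hη := eta_mul_L_pow (P := F.P K) k
    intro h0; rw [h0, zero_mul] at hη; exact zero_ne_one hη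
  have hA : evLit F N K k Ω U₀ A = ((((F.P K).eta k : ℝ) : ℂ))⁻¹ • Y := by
    rw [hYdef, smul_smul, inv_mul_cancel₀ hηne, one_smul]
  -- rewrite `C(t•A′)(c)` as first summand minus `t • Q_k(U₀)A′`
  have hfun : (fun t : ℝ => NegSup.equiv _ _ (COfRecord F N K k Ω U₀ levB ((t : ℂ) • A)) c) =
      fun t : ℝ => (Complex.I⁻¹ : ℂ) • mlog (iterMh k (expOver U₀ ((t : ℂ) • Y)) c *
          star ((Averaging.iter (avOfRecord F N K) k U₀ c : SU N) : Matrix (Fin N) (Fin N) ℂ))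
        - (t : ℂ) • qCplxOp k U₀ (evLit F N K k Ω U₀ A) c := by
    funext t
    rw [COfRecord_apply, map_smul, map_smul, Pi.smul_apply, hYdef, smul_comm]
  rw [hfun]
  have h1 := hasDerivAt_logAvgChart_line F k U₀ hU₀ hY hYtr c
  have h2 : HasDerivAt (fun t : ℝ => (t : ℂ) • qCplxOp k U₀ (evLit F N K k Ω U₀ A) c) (qCplxOp k U₀ (evLit F N K k Ω U₀ A) c) 0 := by
    have h := (Complex.ofRealCLM.hasDerivAt (x := (0 : ℝ))).smul_const (qCplxOp k U₀ (evLit F N K k Ω U₀ A) c)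
    rw [Complex.ofRealCLM_apply, Complex.ofReal_one, one_smul] at h
    exact h
  have hzero : (Complex.I⁻¹ : ℂ) • (dIterL k (coeField U₀) (fun b => (Complex.I • Y b) * (U₀ b : Matrix (Fin N) (Fin N) ℂ)) c *
        star ((Averaging.iter (avOfRecord F N K) k U₀ c : SU N) : Matrix (Fin N) (Fin N) ℂ)) - qCplxOp k U₀ (evLit F N K k Ω U₀ A) c = 0 := by
    rw [hA, qCplxOp_of_herm_eq F k U₀ hU₀ hY c, sub_self]
  have hsub := h1.sub h2
  rw [hzero] at hsub
  exact hsub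

/-- `deriv` form of T-C1′. [cite: Balaban1985Variational, (44) p.285] -/
theorem deriv_COfRecord_line_zero (hU₀ : SmallBelow (avOfRecord F N K) k U₀) (A : Space115Lit F N K k Ω U₀)
    (hH : ∀ b, star (evLit F N K k Ω U₀ A b) = evLit F N K k Ω U₀ A b) (htr : ∀ b, (evLit F N K k Ω U₀ A b).trace = 0) (c : PBond (F.P K) k) :
    deriv (fun t : ℝ => NegSup.equiv _ _ (COfRecord F N K k Ω U₀ levB ((t : ℂ) • A)) c) 0 = 0 :=
  (hasDerivAt_COfRecord_line_zero F k Ω U₀ levB hU₀ A hH htr c).deriv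

end Record

end Summit.QuantumFields.YangMills.Theorems.N07ConstraintLetterTangent
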